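import Summits.QuantumFields.GaugeBoot.CubicTorusFrames
import Summits.QuantumFields.GaugeBoot.TiltedSiteRPPositivity
import Summits.QuantumFields.GaugeBoot.TiltedLinkRPPositivity
import Literature.MathematicalPhysics.QuantumLattice.GaugeGroups
import HarnessLib

/-!
# Site and link reflection positivity of the torus Wilson measure along every axis
# (gauge-boot, L3 structural supplement, part 2 of 2: the cubic torus in the frame theory)

HONEST FRAMING (cell `pub-gaugeboot`, page 1 of every file): the venture produces certified bounds
on lattice expectations at stated coupling, gauge group, dimension and torus size; NOT a mass gap,
NOT a continuum limit, NOT a string tension; NOT Yang–Mills-summit-bearing (barriers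
`FixedCouplingUltralocality`, `PerturbativeInvisibility`). This module bounds no expectation.

Part 1 (`CubicTorusFrames.lean`) put the site frame `(x_k ↦ -x_k, x ↦ x_k)` on the cubic torus
`(ℤ/2Q)^d = Site d (2Q)` along every axis `k` (`isSiteFrame_cubicTorus`, `Q ≥ 2`; and showed that no
other side and no other frame occurs). The lane's mechanism theorems
`IsSiteFrame.integral_conj_mul_nonneg` (`TiltedSiteRPPositivity.lean`, reflection THROUGH sites) and
`IsSiteFrame.linkRP_integral_conj_mul_nonneg` (`TiltedLinkRPPositivity.lean`, reflection BETWEEN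
layers), written for an arbitrary finite periodic lattice, therefore give — through the
identification `gibbs_cubicUnit_eq_wilsonMeasure` of the periodic Wilson measure at `e = cubicUnit`
with the torus Wilson measure `wilsonMeasure ρ β` of `ConstructiveQFTWave0` —

* `cubicTorus_siteRP`, `cubicTorus_siteRP_blocks_nonneg`, `cubicTorus_integral_comp_configReflect`:
  **site-hyperplane reflection positivity of `wilsonMeasure ρ β` along EVERY axis `k`** of the even
  torus (compact second countable `G`, continuous `ρ`, `β ≥ 0`, bounded measurable observables of
  the closed half `{0 ≤ x_k ≤ Q}`), positive semidefinite site RP blocks (the form a torus bootstrap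
  consumes as Kazakov–Zheng's first family), reflection invariance (every real `β`);
* `cubicTorus_linkRP`, `cubicTorus_linkRP_blocks_nonneg`, `cubicTorus_integral_comp_configMidReflect`:
  the same for the **link (mid-plane) reflection `x_k ↦ 1 - x_k`** and observables of
  `{1 ≤ x_k ≤ Q}` (Kazakov–Zheng's second family);
* `cubicTorus_siteRP_negReflect`, `cubicTorus_linkRP_timeReflect`: the axis-`0` statements written
  with Wave 0's own reflections `GaugeConfig.negReflect` (`Θ'`) and `GaugeConfig.timeReflect` (`Θ`)
  (`configReflect_cubicUnit_zero`, `configMidReflect_cubicUnit_zero` of part 1);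
* `cubicTorus_siteRP_suN`, `cubicTorus_linkRP_suN`, `cubicTorus_siteRP_uN`, `cubicTorus_linkRP_uN`:
  the venture's gauge groups — `SU(N)` and `U(N)` lattice gauge theory in the fundamental
  representation on the even torus `(ℤ/2Q)^d` (the setting of the cell's torus certificates), every
  axis, `β ≥ 0`.

The tree's Wave 0 theorems `wilsonExpectation_siteReflectionPositive` (`Θ'`) and
`wilsonExpectation_reflectionPositive_holds` (`Θ`) are the axis-`0` statements for Wave 0's
observable classes (`sitePosEdges ∪ sharedEdges`, `IsPositiveTimeObservable`) and every even `L ≥ 2`;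
here every axis comes out of one mechanism, for the frame's half-space observable classes
(`IsHalfObservable`, `IsMidObservable`) and `L = 2Q ≥ 4`. The odd torus carries no frame
(`not_isSiteFrame_cubicTorus_odd`) — its reflection positivity is Wave 0's
`wilsonExpectation_oddReflectionPositive`, outside the frame mechanism.

References: K. Osterwalder, E. Seiler, Ann. Phys. 110 (1978) 440, §2; E. Seiler, LNP 159 (1982)
Ch. 2; J. Fröhlich, R. Israel, E. H. Lieb, B. Simon, Comm. Math. Phys. 62 (1978) 1, Thm. 2.1;
M. Lüscher, Comm. Math. Phys. 54 (1977) 283; P. Menotti, A. Pelissetto, Comm. Math. Phys. 113 (1987)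
369, §2; I. Montvay, G. Münster, Quantum Fields on a Lattice (1994) pp. 180–185; V. Kazakov,
Z. Zheng, arXiv:2203.11360 §3.1.
-/

open MeasureTheory Complex
open scoped ComplexOrder ComplexConjugate
open Literature.MathematicalPhysics.QuantumFieldTheory (Site GaugeConfig wilsonMeasure)
open Literature.MathematicalPhysics.QuantumLattice (fundamentalRep unitaryFundamentalRep
  continuous_fundamentalRep continuous_unitaryFundamentalRep)

namespace Summit.QuantumFields.GaugeBoot

namespace TiltedRP

/-! ## Site and link reflection positivity of the torus Wilson measure along every axis -/

section RP

variable {d Q N : ℕ} [NeZero Q]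
variable {G : Type} [Group G] [TopologicalSpace G] [IsTopologicalGroup G] [CompactSpace G]
  [MeasurableSpace G] [BorelSpace G] [SecondCountableTopology G]
variable (ρ : G →* Matrix (Fin N) (Fin N) ℂ)

/-- **Site-hyperplane reflection positivity of the torus Wilson measure along every axis**
(Osterwalder–Seiler 1978 §2; Fröhlich–Israel–Lieb–Simon 1978 Thm. 2.1; Lüscher 1977). On the even
torus `(ℤ/2Q)^d`, `Q ≥ 2`, for a compact second countable `G`, continuous `ρ`, `β ≥ 0`, every axis
`k` and every bounded measurable `F` of the closed half `{0 ≤ x_k ≤ Q}`: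
`0 ≤ ∫ conj F(Θ'U) · F(U) dμ_β(U)`, `μ_β = wilsonMeasure ρ β` the Wilson measure of
`ConstructiveQFTWave0`, `Θ'` the reflection in the lattice hyperplane `x_k = 0` (`k`-links reversed
and inverted). -/
theorem cubicTorus_siteRP (hQ : 2 ≤ Q) (k : Fin d) (hρ : Continuous ρ) {β : ℝ} (hβ : 0 ≤ β)
    (F : GaugeConfig d (2 * Q) G → ℂ) (hFm : Measurable F) (hFb : ∃ C : ℝ, ∀ U, ‖F U‖ ≤ C)
    (hFo : IsHalfObservable (cubicUnit d (2 * Q)) Q (cubicAxisCoord d (2 * Q) k) F) :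
    0 ≤ ∫ U, conj (F (configReflect (cubicUnit d (2 * Q)) k (cubicAxisReflect d (2 * Q) k) U)) * F U
      ∂(wilsonMeasure (d := d) (L := 2 * Q) ρ β) := by
  rw [← gibbs_cubicUnit_eq_wilsonMeasure ρ hρ β]
  exact (isSiteFrame_cubicTorus d hQ k).integral_conj_mul_nonneg ρ hρ hβ F hFm hFb hFo

/-- **The site RP blocks of the torus are positive semidefinite** (every axis `k`, `L = 2Q ≥ 4`,
`β ≥ 0`): for bounded measurable half-space observables `F_1, …, F_n` and `c ∈ ℂ^n`,
`0 ≤ ∑_{a,b} conj c_a · c_b · ⟨conj(F_a ∘ Θ') F_b⟩_β` — the form of a site reflection-positivity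
block of a torus bootstrap. -/
theorem cubicTorus_siteRP_blocks_nonneg (hQ : 2 ≤ Q) (k : Fin d) (hρ : Continuous ρ) {β : ℝ}
    (hβ : 0 ≤ β) {n : ℕ} (F : Fin n → GaugeConfig d (2 * Q) G → ℂ) (hFm : ∀ a, Measurable (F a))
    (hFb : ∀ a, ∃ C : ℝ, ∀ U, ‖F a U‖ ≤ C)
    (hFo : ∀ a, IsHalfObservable (cubicUnit d (2 * Q)) Q (cubicAxisCoord d (2 * Q) k) (F a))
    (c : Fin n → ℂ) :
    0 ≤ ∑ a, ∑ b, conj (c a) * c b *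
      ∫ U, conj (F a (configReflect (cubicUnit d (2 * Q)) k (cubicAxisReflect d (2 * Q) k) U)) * F b U
        ∂(wilsonMeasure (d := d) (L := 2 * Q) ρ β) := by
  rw [← gibbs_cubicUnit_eq_wilsonMeasure ρ hρ β]
  exact (isSiteFrame_cubicTorus d hQ k).sum_mul_conj_integral_nonneg ρ hρ hβ F hFm hFb hFo c

/-- **The torus Wilson measure is invariant under the site reflection `x_k ↦ -x_k`** (every axis
`k`, `L = 2Q ≥ 4`; every real `β`, measurable real `F`). -/
theorem cubicTorus_integral_comp_configReflect (hQ : 2 ≤ Q) (k : Fin d) (hρ : Continuous ρ)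
    (β : ℝ) {F : GaugeConfig d (2 * Q) G → ℝ} (hFm : Measurable F) :
    ∫ U, F (configReflect (cubicUnit d (2 * Q)) k (cubicAxisReflect d (2 * Q) k) U)
        ∂(wilsonMeasure (d := d) (L := 2 * Q) ρ β) =
      ∫ U, F U ∂(wilsonMeasure (d := d) (L := 2 * Q) ρ β) := by
  rw [← gibbs_cubicUnit_eq_wilsonMeasure ρ hρ β]
  exact (isSiteFrame_cubicTorus d hQ k).integral_comp_configReflect_gibbs ρ hρ β hFm

/-- **Link-hyperplane (mid-plane) reflection positivity of the torus Wilson measure along every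
axis** (Osterwalder–Seiler 1978 §2; Seiler LNP 159 Ch. 2). On the even torus `(ℤ/2Q)^d`, `Q ≥ 2`,
for a compact second countable `G`, continuous `ρ`, `β ≥ 0`, every axis `k` and every bounded
measurable `F` depending only on the links with both endpoints in `{1 ≤ x_k ≤ Q}`:
`0 ≤ ∫ conj F(ΘU) · F(U) dμ_β(U)`, `Θ` the reflection in the hyperplane `x_k = ½` (`k`-links
crossing `x_k = ½`, `x_k = Q + ½` reversed and inverted). -/
theorem cubicTorus_linkRP (hQ : 2 ≤ Q) (k : Fin d) (hρ : Continuous ρ) {β : ℝ} (hβ : 0 ≤ β)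
    (F : GaugeConfig d (2 * Q) G → ℂ) (hFm : Measurable F) (hFb : ∃ C : ℝ, ∀ U, ‖F U‖ ≤ C)
    (hFo : IsMidObservable (cubicUnit d (2 * Q)) Q (cubicAxisCoord d (2 * Q) k) F) :
    0 ≤ ∫ U, conj (F (configMidReflect (cubicUnit d (2 * Q)) k (cubicAxisReflect d (2 * Q) k) U)) *
      F U ∂(wilsonMeasure (d := d) (L := 2 * Q) ρ β) := by
  rw [← gibbs_cubicUnit_eq_wilsonMeasure ρ hρ β]
  exact (isSiteFrame_cubicTorus d hQ k).linkRP_integral_conj_mul_nonneg ρ hρ hβ F hFm hFb hFo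

/-- **The link RP blocks of the torus are positive semidefinite** (every axis `k`, `L = 2Q ≥ 4`,
`β ≥ 0`): for bounded measurable observables `F_1, …, F_n` of `{1 ≤ x_k ≤ Q}` and `c ∈ ℂ^n`,
`0 ≤ ∑_{a,b} conj c_a · c_b · ⟨conj(F_a ∘ Θ) F_b⟩_β` — the form of a link reflection-positivity
block of a torus bootstrap. -/
theorem cubicTorus_linkRP_blocks_nonneg (hQ : 2 ≤ Q) (k : Fin d) (hρ : Continuous ρ) {β : ℝ}
    (hβ : 0 ≤ β) {n : ℕ} (F : Fin n → GaugeConfig d (2 * Q) G → ℂ) (hFm : ∀ a, Measurable (F a))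
    (hFb : ∀ a, ∃ C : ℝ, ∀ U, ‖F a U‖ ≤ C)
    (hFo : ∀ a, IsMidObservable (cubicUnit d (2 * Q)) Q (cubicAxisCoord d (2 * Q) k) (F a))
    (c : Fin n → ℂ) :
    0 ≤ ∑ a, ∑ b, conj (c a) * c b *
      ∫ U, conj (F a (configMidReflect (cubicUnit d (2 * Q)) k (cubicAxisReflect d (2 * Q) k) U)) *
        F b U ∂(wilsonMeasure (d := d) (L := 2 * Q) ρ β) := by
  rw [← gibbs_cubicUnit_eq_wilsonMeasure ρ hρ β]
  exact (isSiteFrame_cubicTorus d hQ k).linkRP_sum_mul_conj_integral_nonneg ρ hρ hβ F hFm hFb hFo c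

/-- **The torus Wilson measure is invariant under the link reflection `x_k ↦ 1 - x_k`** (every axis
`k`, `L = 2Q ≥ 4`; every real `β`, measurable real `F`). -/
theorem cubicTorus_integral_comp_configMidReflect (hQ : 2 ≤ Q) (k : Fin d) (hρ : Continuous ρ)
    (β : ℝ) {F : GaugeConfig d (2 * Q) G → ℝ} (hFm : Measurable F) :
    ∫ U, F (configMidReflect (cubicUnit d (2 * Q)) k (cubicAxisReflect d (2 * Q) k) U)
        ∂(wilsonMeasure (d := d) (L := 2 * Q) ρ β) =
      ∫ U, F U ∂(wilsonMeasure (d := d) (L := 2 * Q) ρ β) := by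
  rw [← gibbs_cubicUnit_eq_wilsonMeasure ρ hρ β]
  exact (isSiteFrame_cubicTorus d hQ k).integral_comp_configMidReflect_gibbs ρ hρ β hFm

/-- **Along the time axis, in Wave 0's notation**: site reflection positivity of `wilsonMeasure`
for Wave 0's `Θ' = GaugeConfig.negReflect` and the frame's half-space observables (`d ≥ 1`,
`L = 2Q ≥ 4`, `β ≥ 0`). -/
theorem cubicTorus_siteRP_negReflect [NeZero d] (hQ : 2 ≤ Q) (hρ : Continuous ρ) {β : ℝ}
    (hβ : 0 ≤ β) (F : GaugeConfig d (2 * Q) G → ℂ) (hFm : Measurable F)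
    (hFb : ∃ C : ℝ, ∀ U, ‖F U‖ ≤ C)
    (hFo : IsHalfObservable (cubicUnit d (2 * Q)) Q (cubicAxisCoord d (2 * Q) 0) F) :
    0 ≤ ∫ U, conj (F U.negReflect) * F U ∂(wilsonMeasure (d := d) (L := 2 * Q) ρ β) := by
  have h := cubicTorus_siteRP ρ hQ 0 hρ hβ F hFm hFb hFo
  simp_rw [configReflect_cubicUnit_zero] at h
  exact h

/-- **Along the time axis, in Wave 0's notation**: link reflection positivity of `wilsonMeasure`
for Wave 0's `Θ = GaugeConfig.timeReflect` and the frame's mid-half observables (`d ≥ 1`,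
`L = 2Q ≥ 4`, `β ≥ 0`). -/
theorem cubicTorus_linkRP_timeReflect [NeZero d] (hQ : 2 ≤ Q) (hρ : Continuous ρ) {β : ℝ}
    (hβ : 0 ≤ β) (F : GaugeConfig d (2 * Q) G → ℂ) (hFm : Measurable F)
    (hFb : ∃ C : ℝ, ∀ U, ‖F U‖ ≤ C)
    (hFo : IsMidObservable (cubicUnit d (2 * Q)) Q (cubicAxisCoord d (2 * Q) 0) F) :
    0 ≤ ∫ U, conj (F U.timeReflect) * F U ∂(wilsonMeasure (d := d) (L := 2 * Q) ρ β) := by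
  have h := cubicTorus_linkRP ρ hQ 0 hρ hβ F hFm hFb hFo
  simp_rw [configMidReflect_cubicUnit_zero] at h
  exact h

end RP

/-! ## The venture's gauge groups: `SU(N)` and `U(N)` on the even torus -/

section GaugeGroups

variable {d Q N : ℕ} [NeZero Q]

/-- **Site-hyperplane RP of `SU(N)` lattice Yang–Mills on the even torus `(ℤ/2Q)^d` along every
axis `k`** (fundamental representation, Wilson action, `wilsonMeasure`; `Q ≥ 2`, `β ≥ 0`; every `N`,
every `d`). -/
theorem cubicTorus_siteRP_suN (hQ : 2 ≤ Q) (k : Fin d) {β : ℝ} (hβ : 0 ≤ β)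
    (F : GaugeConfig d (2 * Q) (Matrix.specialUnitaryGroup (Fin N) ℂ) → ℂ) (hFm : Measurable F)
    (hFb : ∃ C : ℝ, ∀ U, ‖F U‖ ≤ C)
    (hFo : IsHalfObservable (cubicUnit d (2 * Q)) Q (cubicAxisCoord d (2 * Q) k) F) :
    0 ≤ ∫ U, conj (F (configReflect (cubicUnit d (2 * Q)) k (cubicAxisReflect d (2 * Q) k) U)) * F U
      ∂(wilsonMeasure (d := d) (L := 2 * Q) (fundamentalRep (Fin N)) β) := by
  haveI : SecondCountableTopology (Matrix (Fin N) (Fin N) ℂ) :=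
    inferInstanceAs (SecondCountableTopology (Fin N → Fin N → ℂ))
  haveI : SecondCountableTopology (Matrix.specialUnitaryGroup (Fin N) ℂ) :=
    Topology.IsEmbedding.subtypeVal.secondCountableTopology
  exact cubicTorus_siteRP (fundamentalRep (Fin N)) hQ k (continuous_fundamentalRep (Fin N)) hβ F hFm
    hFb hFo

/-- **Link-hyperplane RP of `SU(N)` lattice Yang–Mills on the even torus `(ℤ/2Q)^d` along every
axis `k`** (fundamental representation; `Q ≥ 2`, `β ≥ 0`; every `N`, every `d`). -/
theorem cubicTorus_linkRP_suN (hQ : 2 ≤ Q) (k : Fin d) {β : ℝ} (hβ : 0 ≤ β)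
    (F : GaugeConfig d (2 * Q) (Matrix.specialUnitaryGroup (Fin N) ℂ) → ℂ) (hFm : Measurable F)
    (hFb : ∃ C : ℝ, ∀ U, ‖F U‖ ≤ C)
    (hFo : IsMidObservable (cubicUnit d (2 * Q)) Q (cubicAxisCoord d (2 * Q) k) F) :
    0 ≤ ∫ U, conj (F (configMidReflect (cubicUnit d (2 * Q)) k (cubicAxisReflect d (2 * Q) k) U)) *
      F U ∂(wilsonMeasure (d := d) (L := 2 * Q) (fundamentalRep (Fin N)) β) := by
  haveI : SecondCountableTopology (Matrix (Fin N) (Fin N) ℂ) :=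
    inferInstanceAs (SecondCountableTopology (Fin N → Fin N → ℂ))
  haveI : SecondCountableTopology (Matrix.specialUnitaryGroup (Fin N) ℂ) :=
    Topology.IsEmbedding.subtypeVal.secondCountableTopology
  exact cubicTorus_linkRP (fundamentalRep (Fin N)) hQ k (continuous_fundamentalRep (Fin N)) hβ F hFm
    hFb hFo

/-- **Site-hyperplane RP of `U(N)` lattice gauge theory on the even torus along every axis `k`**
(fundamental representation; `Q ≥ 2`, `β ≥ 0`; every `N`, `U(1)` included). -/
theorem cubicTorus_siteRP_uN (hQ : 2 ≤ Q) (k : Fin d) {β : ℝ} (hβ : 0 ≤ β)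
    (F : GaugeConfig d (2 * Q) (Matrix.unitaryGroup (Fin N) ℂ) → ℂ) (hFm : Measurable F)
    (hFb : ∃ C : ℝ, ∀ U, ‖F U‖ ≤ C)
    (hFo : IsHalfObservable (cubicUnit d (2 * Q)) Q (cubicAxisCoord d (2 * Q) k) F) :
    0 ≤ ∫ U, conj (F (configReflect (cubicUnit d (2 * Q)) k (cubicAxisReflect d (2 * Q) k) U)) * F U
      ∂(wilsonMeasure (d := d) (L := 2 * Q) (unitaryFundamentalRep (Fin N) ℂ) β) := by
  haveI : SecondCountableTopology (Matrix (Fin N) (Fin N) ℂ) :=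
    inferInstanceAs (SecondCountableTopology (Fin N → Fin N → ℂ))
  haveI : SecondCountableTopology (Matrix.unitaryGroup (Fin N) ℂ) :=
    Topology.IsEmbedding.subtypeVal.secondCountableTopology
  exact cubicTorus_siteRP (unitaryFundamentalRep (Fin N) ℂ) hQ k
    (continuous_unitaryFundamentalRep (n := Fin N) (𝕜 := ℂ)) hβ F hFm hFb hFo

/-- **Link-hyperplane RP of `U(N)` lattice gauge theory on the even torus along every axis `k`**
(fundamental representation; `Q ≥ 2`, `β ≥ 0`; every `N`, `U(1)` included). -/
theorem cubicTorus_linkRP_uN (hQ : 2 ≤ Q) (k : Fin d) {β : ℝ} (hβ : 0 ≤ β)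
    (F : GaugeConfig d (2 * Q) (Matrix.unitaryGroup (Fin N) ℂ) → ℂ) (hFm : Measurable F)
    (hFb : ∃ C : ℝ, ∀ U, ‖F U‖ ≤ C)
    (hFo : IsMidObservable (cubicUnit d (2 * Q)) Q (cubicAxisCoord d (2 * Q) k) F) :
    0 ≤ ∫ U, conj (F (configMidReflect (cubicUnit d (2 * Q)) k (cubicAxisReflect d (2 * Q) k) U)) *
      F U ∂(wilsonMeasure (d := d) (L := 2 * Q) (unitaryFundamentalRep (Fin N) ℂ) β) := by
  haveI : SecondCountableTopology (Matrix (Fin N) (Fin N) ℂ) :=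
    inferInstanceAs (SecondCountableTopology (Fin N → Fin N → ℂ))
  haveI : SecondCountableTopology (Matrix.unitaryGroup (Fin N) ℂ) :=
    Topology.IsEmbedding.subtypeVal.secondCountableTopology
  exact cubicTorus_linkRP (unitaryFundamentalRep (Fin N) ℂ) hQ k
    (continuous_unitaryFundamentalRep (n := Fin N) (𝕜 := ℂ)) hβ F hFm hFb hFo

end GaugeGroups

end TiltedRP

end Summit.QuantumFields.GaugeBoot
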